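import Mathlib
import HarnessLib
import Summits.KontsevichZagierPeriods.KontsevichZagierPeriods.Theses.LinRedNormalForm
import Summits.KontsevichZagierPeriods.KontsevichZagierPeriods.Theorems.LinRedNormalFormDihedralNormalFormStubDilationNLAux4
import Literature.NumberTheory.Transcendental.KZCalculus

/-!
# `DihedralNormalForm`, line `torus-descent-sum-shadow`: stub `stub_dilationNL` (the Euler / dilation move on the simplex)

The registered stub `stub_dilationNL` of the crux `DihedralNormalForm`
(stmt-KontsevichZagierPeriods-3912, route `LinRedNormalForm`, line `torus-descent-sum-shadow`):
**the Euler / dilation Newton–Leibniz move on the open ordered simplex**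
`Δᵏ⁺¹ = {1 > t₀ > ⋯ > t_k > 0}`.  For the simplicial Laurent monomial
`F = q · ∏ tᵢ^{βᵢ} (1 - tᵢ)^{γᵢ} ∏_{i<j} (tᵢ - tⱼ)^{αᵢⱼ}` and a slot `m`, the dilation field
`D = Σ_{j ≥ m} tⱼ ∂ⱼ` of the small variables gives
`[Δᵏ⁺¹, (D + (k+1-m)) F] ≡ [Δᵏ, (t_m F)|_{t_m → t_{m-1}}]` modulo `KZ.relations`
(`t_m → 1` when `m = 0`), provided the exit letter `t_{m-1} - t_m` (resp. `1 - t₀`) has exponent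
`≥ 0` and the total weight `(k+1-m) + Σ_{j ≥ m} βⱼ + Σ_{m ≤ i < j} αᵢⱼ` of the dilated letters is
positive (the entry face `t_{≥ m} → 0` is invisible).

The chain of moves: the dilation chart `dch m` (`tᵢ ↦ tᵢ t_{m-1}/t_m` for `i > m`, Aux 2) is ONE
rule-2 move of `R = [Δᵏ⁺¹, (D + (k+1-m))F]` onto the straightened representation on the open band
`{(tⱼ)_{j≠m} ∈ Δᵏ, 0 < t_m < t_{m-1}}` (Aux 3: image; Jacobian `(t_{m-1}/t_m)^{k-m}`), where `D`
becomes `t_m ∂_m`; relabel `m ↦ last` (rule 2, `KZ.of_sub_of_reindex_mem_relations`); close the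
band by the two null graphs `t = 0`, `t = t_{m-1}` and integrate the axis out by ONE Newton–Leibniz
move (`descents_closeBand`) with the primitive `P = t_m^{k+1-m}/t_{m-1}^{k-m} · F ∘ dinv` (Aux 4:
`∂P = ` kernel on the open fibre, `P` continuous on the closed fibre, `P(0) = 0`,
`P(t_{m-1}) = t_{m-1} · F(face point)`).

References: M. Kontsevich, D. Zagier, *Periods* (2001), §1.2 (rules (2), (3)); F. Brown,
*Multiple zeta values and periods of moduli spaces* (2009), §8 (Stokes on the cell).
-/

noncomputable section

open MeasureTheory Set

namespace Summit.KontsevichZagierPeriods.DihedralNormalForm.TorusDescent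

open Literature.NumberTheory.Transcendental
open Literature.ModelTheory.ExponentialFields (IsSemialgebraic)
open Summit.KontsevichZagierPeriods.DihedralNormalForm.VertexSplitting
open Summit.KontsevichZagierPeriods.FurushoPentagon.HoffmanRelationInKZ

namespace Dilation

variable {k : ℕ} (m : Fin (k + 1)) (q : ℚ) (β γ : Fin (k + 1) → ℤ) (α : Fin (k + 1) → Fin (k + 1) → ℤ)

/-! ### The primitive on the band and the Jacobian factor -/

/-- The primitive read on band coordinates: `t_m^{k+1-m} / H^{k-m} · smono (dinv m t)`. -/
def primB (t : Fin (k + 1) → ℝ) : ℝ :=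
  t m ^ (k + 1 - (m : ℕ)) / hiC m t ^ (k - (m : ℕ)) * smono q β γ α (dinv m t)

/-- On an inserted tuple the band primitive is the fibre primitive. -/
theorem primB_insertNth (y : Fin k → ℝ) (u : ℝ) :
    primB m q β γ α (Fin.insertNth m u y) = prim m q β γ α y u := by
  unfold primB prim fib
  rw [Fin.insertNth_apply_same, hiC_insertNth]

/-- The band primitive is `ℚ`-semialgebraic on every `ℚ`-semialgebraic set.
[cite: BochnakCosteRoy1998, Prop. 2.2.6] -/
theorem isSemialgebraicFunOn_primB {S : Set (Fin (k + 1) → ℝ)} (hS : IsSemialgebraic ℚ S) :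
    IsSemialgebraicFunOn ℚ S (primB m q β γ α) := by
  unfold primB
  refine IsSemialgebraicFunOn.fun_mul ?_
    (isSemialgebraicFunOn_smono_comp hS q β γ α (isSemialgebraicFunOn_dinv_apply m hS))
  exact (((isSemialgebraicFunOn_apply hS m).fun_pow _).fun_mul
    ((isSemialgebraicFunOn_hiC hS m).fun_pow _).fun_inv).congr fun t _ => by rw [div_eq_mul_inv]

/-- The Jacobian factor `(t_m / H)^{k-m}` of the inverse chart. -/
def jac (t : Fin (k + 1) → ℝ) : ℝ := (t m / hiC m t) ^ (k - (m : ℕ))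

/-- The Jacobian factor is `ℚ`-semialgebraic. [cite: BochnakCosteRoy1998, Prop. 2.2.6] -/
theorem isSemialgebraicFunOn_jac {S : Set (Fin (k + 1) → ℝ)} (hS : IsSemialgebraic ℚ S) :
    IsSemialgebraicFunOn ℚ S (jac m) :=
  (((isSemialgebraicFunOn_apply hS m).fun_mul (isSemialgebraicFunOn_hiC hS m).fun_inv).fun_pow _).congr
    fun t _ => by rw [jac, div_eq_mul_inv]

/-- The Jacobian factor at the image point cancels the Jacobian determinant of the chart. -/
theorem jac_dch_mul_abs_det {t : Fin (k + 1) → ℝ} (ht : t ∈ KZ.openOrderedSimplex (k + 1)) :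
    jac m (dch m t) * |(dchD m t).det| = 1 := by
  have h1 : 0 < t m := ht.1 m
  have h2 : 0 < hiC m t := hiC_pos_of_mem m ht
  rw [jac, dch_self, hiC_dch, abs_det_dchD m h1 h2, ← mul_pow, div_mul_div_comm, mul_comm (hiC m t),
    div_self (mul_pos h1 h2).ne', one_pow]

/-! ### The straightened representation (one change of variables) -/

/-- **The straightened representation** `[oband m, (R.integrand ∘ dinv m) · jac m]`: the pull-back
of `R = [Δᵏ⁺¹, R.integrand]` along the inverse chart (integrable by
`MeasureTheory.integrableOn_image_iff_integrableOn_abs_det_fderiv_smul`). -/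
def strRep (R : KZ.IntegralRep (k + 1)) (hR : R.domain = KZ.openOrderedSimplex (k + 1)) :
    KZ.IntegralRep (k + 1) where
  domain := oband m
  integrand := fun t => R.integrand (dinv m t) * jac m t
  isSemialgebraic_domain := isSemialgebraic_oband m
  isSemialgebraicFunOn_integrand :=
    IsSemialgebraicFunOn.fun_mul
      (IsSemialgebraicFunOn.comp_isSemialgebraicMapOn_holds (hR ▸ R.isSemialgebraicFunOn_integrand)
        (isSemialgebraicMapOn_dinv m (isSemialgebraic_oband m)) (fun t ht => dinv_mem_simplex m ht))
      (isSemialgebraicFunOn_jac m (isSemialgebraic_oband m))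
  integrableOn := by
    have hΔ : MeasurableSet (KZ.openOrderedSimplex (k + 1)) := KZ.measurableSet_openOrderedSimplex _
    have h := (integrableOn_image_iff_integrableOn_abs_det_fderiv_smul volume hΔ
      (fun t ht => (hasFDerivAt_dch m (ht.1 m).ne').hasFDerivWithinAt)
      (injOn_dch m fun t ht => ⟨(ht.1 m).ne', (hiC_pos_of_mem m ht).ne'⟩)
      (fun t => R.integrand (dinv m t) * jac m t)).mpr ?_
    · rwa [image_dch] at h
    · refine (hR ▸ R.integrableOn).congr_fun (fun t ht => ?_) hΔ
      rw [smul_eq_mul, dinv_dch m (ht.1 m).ne' (hiC_pos_of_mem m ht).ne', mul_comm, mul_assoc,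
        jac_dch_mul_abs_det m ht, mul_one]

/-- **Rule (2)**: `[R] − [strRep] ∈ KZ.relations` along the dilation chart.
[cite: KontsevichZagier2001, §1.2 rule (2)] -/
theorem of_sub_of_strRep_mem (R : KZ.IntegralRep (k + 1))
    (hR : R.domain = KZ.openOrderedSimplex (k + 1)) :
    KZ.of R - KZ.of (strRep m R hR) ∈ KZ.relations := by
  refine KZ.changeOfVariablesRel_subset_relations
    ⟨k + 1, R, strRep m R hR, dch m, dchD m, ?_, ?_, ?_, ?_, ?_, rfl⟩
  · rw [hR]
    exact isSemialgebraicMapOn_dch m (KZ.isSemialgebraic_openOrderedSimplex _)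
  · intro t ht
    rw [hR] at ht
    exact (hasFDerivAt_dch m (ht.1 m).ne').hasFDerivWithinAt
  · rw [hR]
    exact injOn_dch m fun t ht => ⟨(ht.1 m).ne', (hiC_pos_of_mem m ht).ne'⟩
  · show oband m = dch m '' R.domain
    rw [hR, image_dch]
  · intro t ht
    rw [hR] at ht
    show R.integrand t = R.integrand (dinv m (dch m t)) * jac m (dch m t) * |(dchD m t).det|
    rw [dinv_dch m (ht.1 m).ne' (hiC_pos_of_mem m ht).ne', mul_assoc, jac_dch_mul_abs_det m ht, mul_one]

/-! ### The Newton–Leibniz move along the straightened axis -/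

/-- **Rules (1), (3)**: the straightened representation, relabelled so that the slot is the last
coordinate, minus the face representation `rb = [Δᵏ, H · smono (insertNth m H ·)]` is a relation:
close the open band `{y ∈ Δᵏ, 0 < t < hiEdge m y}` by the null graphs `t = 0`, `t = hiEdge` and
integrate `t` out by ONE Newton–Leibniz move with the primitive `primB` (`descents_closeBand`).
[cite: KontsevichZagier2001, §1.2 rule (3)] -/
theorem of_reindex_sub_of_face_mem (R : KZ.IntegralRep (k + 1))
    (hR : R.domain = KZ.openOrderedSimplex (k + 1))
    (hRint : EqOn R.integrand
      (fun t => smono q β γ α t * (((k : ℝ) + 1 - (m : ℝ)) + brkt m β γ α t)) R.domain)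
    (rb : KZ.IntegralRep k) (hrb : rb.domain = KZ.openOrderedSimplex k)
    (hrbint : EqOn rb.integrand
      (fun y => hiEdge m y * smono q β γ α (Fin.insertNth m (hiEdge m y) y)) rb.domain)
    (hface : if h : 0 < (m : ℕ) then 0 ≤ α ⟨(m : ℕ) - 1, by omega⟩ m else 0 ≤ γ m)
    (hE : 0 < ((k : ℤ) + 1 - (m : ℤ)) + dilExp m β α) :
    KZ.of ((strRep m R hR).reindex (reix m)) - KZ.of rb ∈ KZ.relations := by
  classical
  set R₂ := (strRep m R hR).reindex (reix m) with hR₂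
  have hS := KZ.isSemialgebraic_openOrderedSimplex k
  have hR₂dom : R₂.domain = {w | (Fin.init w : Fin k → ℝ) ∈ KZ.openOrderedSimplex k ∧
      0 < w (Fin.last k) ∧ w (Fin.last k) < hiEdge m (Fin.init w)} := by
    ext w
    rw [hR₂, KZ.IntegralRep.reindex_domain, mem_setOf_eq]
    exact comp_reix_mem_oband_iff m w
  have hR₂int : ∀ w, R₂.integrand w =
      R.integrand (dinv m (fun i => w (reix m i))) * jac m (fun i => w (reix m i)) := fun w => rfl
  -- the edges
  have ha0 : IsSemialgebraicFunOn ℚ (KZ.openOrderedSimplex k) (fun _ : Fin k → ℝ => (0:ℝ)) := by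
    simpa using isSemialgebraicFunOn_const_ratCast hS 0
  have hb0 : IsSemialgebraicFunOn ℚ (KZ.openOrderedSimplex k) (hiEdge m) := isSemialgebraicFunOn_hiEdge hS m
  have hband : IsSemialgebraic ℚ (KZlog.band (KZ.openOrderedSimplex k) (fun _ => 0) (hiEdge m)) :=
    KZlog.isSemialgebraic_band ha0 hb0
  have hsub : R₂.domain ⊆ KZlog.band (KZ.openOrderedSimplex k) (fun _ => 0) (hiEdge m) := by
    intro w hw
    rw [hR₂dom] at hw
    rw [KZlog.mem_band]
    exact ⟨hw.1, hw.2.1.le, hw.2.2.le⟩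
  -- the kernel (glued) and the primitive
  set W : (Fin (k + 1) → ℝ) → ℝ := fun w => if w ∈ R₂.domain then R₂.integrand w else 0 with hW
  set P : (Fin (k + 1) → ℝ) → ℝ := fun w => primB m q β γ α (fun i => w (reix m i)) with hP
  have hPsnoc : ∀ (y : Fin k → ℝ), (fun t : ℝ => P (Fin.snoc y t)) = prim m q β γ α y := by
    intro y
    funext t
    simp only [hP, Nested.snoc_comp_reix, primB_insertNth]
  refine descents_closeBand R₂ rb (fun _ => 0) (hiEdge m) W P (hrb ▸ ha0) (hrb ▸ hb0) ?_ ?_ ?_ ?_ ?_ ?_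
    (hrb.symm ▸ hsub) ?_ ?_
  · intro y hy
    rw [hrb] at hy
    exact (hiEdge_pos m hy).le
  · -- the glued kernel is semialgebraic on the closed band
    rw [hrb, ← union_sdiff_cancel hsub]
    refine IsSemialgebraicFunOn.union R₂.isSemialgebraicFunOn_integrand (g := fun _ => (0:ℝ)) ?_
      (fun w hw => by rw [hW]; exact if_pos hw) (fun w hw => by rw [hW]; exact if_neg hw.2)
    simpa using isSemialgebraicFunOn_const_ratCast (hband.diff R₂.isSemialgebraic_domain) 0
  · -- the primitive is semialgebraic on the closed band
    rw [hrb]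
    have h := Nested.isSemialgebraicFunOn_comp_perm (reix m)
      (isSemialgebraicFunOn_primB m q β γ α (isSemialgebraic_cband0 m))
    convert h using 1
    ext w
    exact (comp_reix_mem_cband0_iff m w).symm
  · -- continuity on the closed fibre
    intro y hy
    rw [hrb] at hy
    rw [hPsnoc]
    exact continuousOn_prim m q β γ α hy hface hE
  · -- the derivative on the open fibre
    intro y hy t ht
    rw [hrb] at hy
    rw [hPsnoc]
    have hmem : (Fin.snoc y t : Fin (k + 1) → ℝ) ∈ R₂.domain := by
      rw [hR₂dom]
      exact ⟨by simpa using hy, by simpa using ht.1, by simpa using ht.2⟩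
    have hfib : dinv m (Fin.insertNth m t y) ∈ R.domain := by
      rw [hR]
      exact dinv_insertNth_mem m hy ht.1 ht.2
    have hWt : W (Fin.snoc y t) = kern m q β γ α y t := by
      rw [hW]
      dsimp only
      rw [if_pos hmem, hR₂int, Nested.snoc_comp_reix, hRint hfib]
      unfold kern jac fib
      rw [Fin.insertNth_apply_same, hiC_insertNth]
      ring
    rw [hWt]
    exact hasDerivAt_prim m q β γ α hy ht.1 ht.2
  · -- the base identity
    intro y hy
    have hy' : y ∈ KZ.openOrderedSimplex k := hrb ▸ hy
    have e1 : P (Fin.snoc y (hiEdge m y)) = prim m q β γ α y (hiEdge m y) := congrFun (hPsnoc y) _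
    have e0 : P (Fin.snoc y 0) = prim m q β γ α y 0 := congrFun (hPsnoc y) _
    rw [e1, e0, prim_zero, sub_zero, prim_hiEdge m q β γ α hy']
    exact hrbint hy
  · intro w hw
    rw [hW]
    exact (if_pos hw).symm
  · -- the collar consists of the two graphs `t = 0`, `t = hiEdge` over the simplex
    refine measure_mono_null ?_ (measure_union_null (KZ.volume_graph_eq_zero ha0)
      (KZ.volume_graph_eq_zero hb0))
    intro w hw
    rw [hrb, mem_sdiff, KZlog.mem_band, hR₂dom] at hw
    obtain ⟨⟨hy, hlo, hhi⟩, hnot⟩ := hw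
    rw [mem_union]
    by_cases hca : w (Fin.last k) = 0
    · exact Or.inl ⟨hy, hca⟩
    · by_cases hcb : w (Fin.last k) = hiEdge m (Fin.init w)
      · exact Or.inr ⟨hy, hcb⟩
      · exact absurd ⟨hy, lt_of_le_of_ne hlo (Ne.symm hca), lt_of_le_of_ne hhi hcb⟩ hnot

/-- **The dilation move** for representations with the literal integrands: `[R] − [rb] ∈ KZ.relations`.
[cite: KontsevichZagier2001, §1.2 rules (2), (3)] -/
theorem dilation_move (R : KZ.IntegralRep (k + 1))
    (hR : R.domain = KZ.openOrderedSimplex (k + 1))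
    (hRint : EqOn R.integrand
      (fun t => smono q β γ α t * (((k : ℝ) + 1 - (m : ℝ)) + brkt m β γ α t)) R.domain)
    (rb : KZ.IntegralRep k) (hrb : rb.domain = KZ.openOrderedSimplex k)
    (hrbint : EqOn rb.integrand
      (fun y => hiEdge m y * smono q β γ α (Fin.insertNth m (hiEdge m y) y)) rb.domain)
    (hface : if h : 0 < (m : ℕ) then 0 ≤ α ⟨(m : ℕ) - 1, by omega⟩ m else 0 ≤ γ m)
    (hE : 0 < ((k : ℤ) + 1 - (m : ℤ)) + dilExp m β α) :
    KZ.of R - KZ.of rb ∈ KZ.relations := by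
  have e1 := of_sub_of_strRep_mem m R hR
  have e2 := KZ.of_sub_of_reindex_mem_relations (strRep m R hR) (reix m)
  have e3 := of_reindex_sub_of_face_mem m q β γ α R hR hRint rb hrb hrbint hface hE
  have h := KZ.relations.add_mem (KZ.relations.add_mem e1 e2) e3
  rwa [sub_add_sub_cancel, sub_add_sub_cancel] at h

end Dilation

open Summit.KontsevichZagierPeriods.DihedralNormalForm.TorusDescent.Dilation in
/-- **`stub_dilationNL`** — THE EULER / DILATION MOVE ON THE SIMPLEX (rule 3 along the flow of
`D = Σ_{j ≥ m} tⱼ ∂ⱼ`, which dilates the small variables `t_m > ⋯ > t_k` of `Δᵏ⁺¹`): for the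
monomial `F = q·∏ tᵢ^{βᵢ}(1-tᵢ)^{γᵢ}∏_{i<j}(tᵢ-tⱼ)^{αᵢⱼ}`, if `R = [Δᵏ⁺¹, (D + (k+1-m))·F]` (the bulk
written out) and `rb = [Δᵏ, (t_m F)|_{t_m → t_{m-1}}]` (`t_m → 1` when `m = 0`) are
representations, the exit letter has exponent `≥ 0` and the total weight of the dilated letters is
positive, then `[R] − [rb] ∈ KZ.relations`: dilation chart (rule 2), relabelling (rule 2), closing
the band and ONE Newton–Leibniz move (rules 1, 3). [cite: KontsevichZagier2001, §1.2 rules (2), (3)] -/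
theorem stub_dilationNL : ∀ (k : ℕ) (m : Fin (k + 1)) (q : ℚ) (β γ : Fin (k + 1) → ℤ) (α : Fin (k + 1) → Fin (k + 1) → ℤ) (R : Literature.NumberTheory.Transcendental.KZ.IntegralRep (k + 1)) (rb : Literature.NumberTheory.Transcendental.KZ.IntegralRep k), R.domain = {t : Fin (k + 1) → ℝ | (∀ i, 0 < t i) ∧ (∀ i, t i < 1) ∧ StrictAnti t} → Set.EqOn R.integrand (fun t => ((q : ℝ) * ((∏ i : Fin (k + 1), t i ^ β i) * (∏ i : Fin (k + 1), (1 - t i) ^ γ i) * ∏ i : Fin (k + 1), ∏ j : Fin (k + 1), if i < j then (t i - t j) ^ α i j else 1)) * ((((k : ℝ) + 1 - (m : ℝ)) + (∑ j : Fin (k + 1), if m ≤ j then (β j : ℝ) else 0) + (∑ i : Fin (k + 1), ∑ j : Fin (k + 1), if m ≤ i ∧ i < j then (α i j : ℝ) else 0)) + (∑ i : Fin (k + 1), ∑ j : Fin (k + 1), if i < m ∧ m ≤ j then (α i j : ℝ) * (-t j) / (t i - t j) else 0) + (∑ j : Fin (k + 1), if m ≤ j then (γ j : ℝ) * (-t j)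 / (1 - t j) else 0))) R.domain → rb.domain = {t : Fin k → ℝ | (∀ i, 0 < t i) ∧ (∀ i, t i < 1) ∧ StrictAnti t} → Set.EqOn rb.integrand (fun y => (if h : 0 < (m : ℕ) then y ⟨(m : ℕ) - 1, by omega⟩ else 1) * ((q : ℝ) * ((∏ i : Fin (k + 1), (Fin.insertNth m (if h : 0 < (m : ℕ) then y ⟨(m : ℕ) - 1, by omega⟩ else 1) y : Fin (k + 1) → ℝ) i ^ β i) * (∏ i : Fin (k + 1), (1 - (Fin.insertNth m (if h : 0 < (m : ℕ) then y ⟨(m : ℕ) - 1, by omega⟩ else 1) y : Fin (k + 1) → ℝ) i) ^ γ i) * ∏ i : Fin (k + 1), ∏ j : Fin (k + 1), if i < j then ((Fin.insertNth m (if h : 0 < (m : ℕ) then y ⟨(m : ℕ) - 1, by omega⟩ else 1) y : Fin (k + 1) → ℝ) i - (Fin.insertNth m (if h : 0 < (m : ℕ) then y ⟨(m : ℕ) - 1, by omega⟩ else 1) y : Fin (k + 1) → ℝ) j) ^ α i j else 1))) rb.domain → (if h : 0 < (m : ℕ) then 0 ≤ α ⟨(m : ℕ) - 1, by omega⟩ m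 else 0 ≤ γ m) → 0 < ((k : ℤ) + 1 - (m : ℤ)) + (∑ j : Fin (k + 1), if m ≤ j then β j else 0) + (∑ i : Fin (k + 1), ∑ j : Fin (k + 1), if m ≤ i ∧ i < j then α i j else 0) → Literature.NumberTheory.Transcendental.KZ.of R - Literature.NumberTheory.Transcendental.KZ.of rb ∈ Literature.NumberTheory.Transcendental.KZ.relations := by
  intro k m q β γ α R rb hRdom hRint hrbdom hrbint hface hE
  have hR : R.domain = KZ.openOrderedSimplex (k + 1) := hRdom
  have hrb : rb.domain = KZ.openOrderedSimplex k := hrbdom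
  have hRint' : EqOn R.integrand
      (fun t => smono q β γ α t * (((k : ℝ) + 1 - (m : ℝ)) + brkt m β γ α t)) R.domain := by
    intro t ht
    rw [hRint ht]
    simp only [smono, brkt]
    ring
  have hrbint' : EqOn rb.integrand
      (fun y => hiEdge m y * smono q β γ α (Fin.insertNth m (hiEdge m y) y)) rb.domain :=
    fun y hy => hrbint hy
  have hE' : 0 < ((k : ℤ) + 1 - (m : ℤ)) + dilExp m β α := by
    unfold dilExp
    rwa [← add_assoc]
  exact dilation_move m q β γ α R hR hRint' rb hrb hrbint' hface hE'

end Summit.KontsevichZagierPeriods.DihedralNormalForm.TorusDescent
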